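import Summits.MatrixMultiplication.MatrixMultiplication.Theses.EisensteinValCertificates
import Summits.MatrixMultiplication.MatrixMultiplication.Theses.GroupTheoreticSTPP
import Literature.Computability.AlgebraicComplexity.PrattTrapezoidValSTPP
import Literature.Computability.AlgebraicComplexity.GroupTheoreticMatMulThmBProofs
import Literature.Barriers.MatrixMultiplication.TricoloredSumFreeBarrier
import Literature.Barriers.MatrixMultiplication.TricoloredSumFreeBarrierEffective

set_option linter.dupNamespace false

/-!
# Strategist sketch (gen 1) — crux `HomocyclicSTPPDesigns` (stmt-MatrixMultiplication-10647)

Typed objects behind `STRATEGY-CENSUS.md` (crux-strategist planner-cstrat-stmt-MatrixMultiplication-10647-h1-0,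
2026-08-17).  `X′ := HomocyclicSTPPDesigns` = "for every ε > 0 some prime power `q`, some `ℓ` and some
STPP family in `(ℤ/q)^ℓ` with `q^ℓ < Σᵢ (|Aᵢ||Bᵢ||Cᵢ|)^((2+ε)/3)`"; `closes : X′ → MatrixMultiplication`
is proved in the route file.  Everything below is sorry-free EXCEPT the one conjecture-grade transfer
statement `largeBlockTransfer` (§3), which is typed with its proof plan and left `sorry` on purpose
(prover-sized; it is a census object, not a claim).

* §1 `cThesis_of_designs` — SANDWICH, upper half (proved): X′ → `GroupTheoreticSTPP.CThesis`
  (all-abelian STPP apex, stmt-0593, which has its own landed `closes`).  With the birth line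
  (`PrimeTwoFamilies → X′`, Cruxes/…/Lines/birth.lean) this places X′ between two summit-deciding
  existence statements: `PrimeTwoFamilies ⟹ X′ ⟹ CThesis ⟹ S`.
* §2 `exists_prime_isSTPP_of_addEquiv` — TRANSFER TOOL (proved): an STPP family in any
  `H ≃+ ∏_{j<k} ℤ/m_j` re-hosts into a PRIME cyclic group `ℤ/p`, `p ≤ 2·3^k·∏ m_j`, with the same
  block sizes (mixed-radix map of the tree + Bertrand).  The factor `3^k` is the whole obstruction to
  "all-abelian apex ⟹ homocyclic apex" (census § Transfer).
* §3 `LargeBlockAbelianDesigns`, `largeBlockTransfer` — TYPED: abelian apex designs whose blocks are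
  `≥ |H|^α₀` transfer to X′ (Umans' cyclic reduction, the SOLVED SIBLING `cyclicReduction_proof` of
  route FourierTwoFamiliesModP, run on STPP instead of SDPP); proof plan in the docstring; the step
  that needs `α₀ > 0` is isolated as the proved lemma `sum_rpow_gain_of_blocks_ge` (§3a).
* §4 `single_shape_packing` — STRENGTHEN/NEGATION calibration (proved): a one-shape family
  `(a,b,c)` has `N · max(ab,bc,ca) ≤ |H|`, so only asymptotically BALANCED shapes can be tight.
* §5 `witness_modulus_lower_bound` — NEGATION, quantitative regime (proved): an X′-witness at `ε`
  has `q > 3·ε_B/ε` (`ε_B = bccgnsuEpsilon`, BCCGNSU Thm B explicit, tree), sharpening the qualitative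
  `designs_need_unbounded_modulus` of Theorems/HomocyclicSTPPDesigns/Negative/Regimes.lean.
-/

namespace Summit.MatrixMultiplication.MatrixMultiplication.Cruxes.HomocyclicSTPPDesigns.Strategist

open Summit.MatrixMultiplication.MatrixMultiplication.Theses.EisensteinValCertificates
open Summit.MatrixMultiplication.MatrixMultiplication.Theses.GroupTheoreticSTPP (CThesis)
open Literature.Computability.AlgebraicComplexity Literature.Barriers.MatrixMultiplication Finset
open scoped BigOperators

/-! ## §1 Sandwich, upper half: homocyclic apex ⟹ all-abelian apex -/

/-- X′ implies the all-abelian STPP apex `CThesis` of route GroupTheoreticSTPP (stmt-0593): take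
`H := Fin ℓ → ZMod q`.  (`CThesis → S` is that route's landed `closes`; so every existence leaf that
implies X′ is summit-deciding in two steps — the structural reason no line for X′ passes BC3 honestly.) -/
theorem cThesis_of_designs (h : HomocyclicSTPPDesigns) : CThesis := by
  intro ε hε
  obtain ⟨q, ℓ, hq, N, A, B, C, hS, hlt⟩ := h ε hε
  haveI : NeZero q := ⟨hq.ne_zero⟩
  refine ⟨Fin ℓ → ZMod q, inferInstance, inferInstance, N, A, B, C, (isSTPP_iff A B C).1 hS, ?_⟩
  have hcard : (Fintype.card (Fin ℓ → ZMod q) : ℝ) = (q : ℝ) ^ ℓ := by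
    rw [Fintype.card_fun, ZMod.card, Fintype.card_fin]; push_cast; rfl
  rw [hcard]
  exact hlt

/-! ## §2 Transfer tool: re-hosting an STPP family in a prime cyclic group -/

/-- **Prime re-hosting of STPP families** (the transfer step of Pratt 2024 Thm 4.4 / Cor 4.5 /
Thm 4.7, arXiv:2309.03878 pp. 9–10, as a design-level lemma): an STPP family in
`H ≃+ ∏_{j<k} ℤ/m_j` (`m_j > 0`) has an image in `ℤ/p` for some prime `p ≤ 2 · 3^k · ∏ m_j` which is
again STPP with the same block sizes.  The loss factor `2·3^k` (carry room per cyclic factor +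
Bertrand) is exactly what a witness must out-grow to move from an arbitrary abelian host to a
homocyclic (indeed prime cyclic) one. -/
theorem exists_prime_isSTPP_of_addEquiv {H : Type*} [AddCommGroup H] {N : ℕ}
    {A B C : Fin N → Finset H} (hS : IsSTPP A B C)
    {k : ℕ} {m : Fin k → ℕ} (hm : ∀ j, 0 < m j) (e : H ≃+ Π j, ZMod (m j)) :
    ∃ p : ℕ, p.Prime ∧ p ≤ 2 * (3 ^ k * ∏ j, m j) ∧
      ∃ A' B' C' : Fin N → Finset (ZMod p), IsSTPP A' B' C' ∧
        ∀ i, (A' i).card = (A i).card ∧ (B' i).card = (B i).card ∧ (C' i).card = (C i).card := by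
  classical
  obtain ⟨ψ, h1, h2⟩ := exists_freiman3_of_addEquiv hm e
  set R : ℕ := 3 ^ k * ∏ j, m j with hR
  have hR0 : R ≠ 0 := by have := h1 0 0 0; omega
  obtain ⟨p, hp, hRp, hp2R⟩ := Nat.exists_prime_lt_and_le_two_mul R hR0
  haveI : Fact p.Prime := ⟨hp⟩
  set φ : H → ZMod p := fun x => ((ψ x : ℕ) : ZMod p) with hφ
  have h3sum : ∀ a b c, ψ a + ψ b + ψ c < p := fun a b c => lt_trans (h1 a b c) hRp
  have hφr : ∀ a b c a' b' c', φ a + φ b + φ c = φ a' + φ b' + φ c' →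
      a + b + c = a' + b' + c' := by
    intro a b c a' b' c' h
    have h' : ((ψ a + ψ b + ψ c : ℕ) : ZMod p) = ((ψ a' + ψ b' + ψ c' : ℕ) : ZMod p) := by
      push_cast; exact h
    rw [ZMod.natCast_eq_natCast_iff', Nat.mod_eq_of_lt (h3sum _ _ _),
      Nat.mod_eq_of_lt (h3sum _ _ _)] at h'
    exact h2 a b c a' b' c' h'
  have hinj := injective_of_reflect φ hφr
  have himg := addSimultaneousTPP_image_of_reflect ((isSTPP_iff_addSimultaneousTPP A B C).1 hS) φ hφr
  exact ⟨p, hp, hp2R, fun i => (A i).image φ, fun i => (B i).image φ, fun i => (C i).image φ,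
    (isSTPP_iff_addSimultaneousTPP _ _ _).2 himg, fun i =>
      ⟨card_image_of_injective _ hinj, card_image_of_injective _ hinj,
        card_image_of_injective _ hinj⟩⟩

/-- Corollary (proved): a witness family in a host with a bounded number `k` of cyclic factors and
with a MARGIN `2·3^k` over the host size is already a prime-cyclic witness.  This is the honest
content of Pratt Cor 4.5's transfer at the level of designs: without the margin nothing moves. -/
theorem prime_witness_of_margin {H : Type*} [AddCommGroup H] {N : ℕ}
    {A B C : Fin N → Finset H} (hS : IsSTPP A B C)
    {k : ℕ} {m : Fin k → ℕ} (hm : ∀ j, 0 < m j) (e : H ≃+ Π j, ZMod (m j)) {τ : ℝ}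
    (hbig : (2 * (3 ^ k * ∏ j, m j) : ℝ) <
      ∑ i, (((A i).card * (B i).card * (C i).card : ℕ) : ℝ) ^ τ) :
    ∃ p : ℕ, p.Prime ∧ ∃ A' B' C' : Fin N → Finset (ZMod p), IsSTPP A' B' C' ∧
      (p : ℝ) < ∑ i, (((A' i).card * (B' i).card * (C' i).card : ℕ) : ℝ) ^ τ := by
  obtain ⟨p, hp, hple, A', B', C', hS', hcard⟩ := exists_prime_isSTPP_of_addEquiv hS hm e
  refine ⟨p, hp, A', B', C', hS', ?_⟩
  have hsum : ∑ i, (((A' i).card * (B' i).card * (C' i).card : ℕ) : ℝ) ^ τ =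
      ∑ i, (((A i).card * (B i).card * (C i).card : ℕ) : ℝ) ^ τ := by
    refine Finset.sum_congr rfl fun i _ => ?_
    obtain ⟨h1, h2, h3⟩ := hcard i
    rw [h1, h2, h3]
  rw [hsum]
  have hp' : (p : ℝ) ≤ (2 * (3 ^ k * ∏ j, m j) : ℝ) := by exact_mod_cast hple
  exact lt_of_le_of_lt hp' hbig

/-! ## §3 The large-block transfer (Umans' cyclic reduction run on STPP) — typed -/

/-- `LargeBlockAbelianDesigns`: the all-abelian STPP apex (`CThesis`) restricted to families whose
every block has volume `|Aᵢ||Bᵢ||Cᵢ| ≥ |H|^α₀` for one fixed `α₀ > 0` (the "α ≥ α₀" slab of the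
design plane; the SDPP lift of CKSU §6 produces `α → 1`, CKSU Thm 33 USP families `α → 1`, singleton
= tricolored-sum-free families `α = 0`). -/
def LargeBlockAbelianDesigns : Prop :=
  ∃ α₀ : ℝ, 0 < α₀ ∧ ∀ ε : ℝ, 0 < ε → ∃ (H : Type) (_ : AddCommGroup H) (_ : Fintype H) (N : ℕ)
    (A B C : Fin N → Finset H), IsSTPP A B C ∧
      (∀ i, (Fintype.card H : ℝ) ^ α₀ ≤ (((A i).card * (B i).card * (C i).card : ℕ) : ℝ)) ∧
      (Fintype.card H : ℝ) < ∑ i, (((A i).card * (B i).card * (C i).card : ℕ) : ℝ) ^ ((2 + ε) / 3)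

/-- §3a — the one step of the transfer that USES `α₀ > 0` (proved): raising the exponent from
`(2+ε')/3` to `(2+ε)/3` multiplies a sum over blocks of volume `≥ M` by at least `M^((ε−ε')/3)`.
For small blocks (`M ≈ 1`) there is no gain — the precise point where "all-abelian ⟹ homocyclic"
breaks (census § Transfer, T1). -/
theorem sum_rpow_gain_of_blocks_ge {ι : Type*} (S : Finset ι) (x : ι → ℕ) {M ε ε' : ℝ}
    (hM : 1 ≤ M) (_hε' : 0 ≤ ε') (hle : ε' ≤ ε) (hx : ∀ i ∈ S, M ≤ (x i : ℝ)) :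
    M ^ ((ε - ε') / 3) * ∑ i ∈ S, ((x i : ℕ) : ℝ) ^ ((2 + ε') / 3) ≤
      ∑ i ∈ S, ((x i : ℕ) : ℝ) ^ ((2 + ε) / 3) := by
  rw [Finset.mul_sum]
  refine Finset.sum_le_sum fun i hi => ?_
  have hxi : M ≤ (x i : ℝ) := hx i hi
  have hx1 : (1 : ℝ) ≤ (x i : ℝ) := le_trans hM hxi
  have hx0 : (0 : ℝ) < (x i : ℝ) := lt_of_lt_of_le one_pos hx1
  have hsplit : ((x i : ℕ) : ℝ) ^ ((2 + ε) / 3) =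
      ((x i : ℕ) : ℝ) ^ ((ε - ε') / 3) * ((x i : ℕ) : ℝ) ^ ((2 + ε') / 3) := by
    rw [← Real.rpow_add hx0]; congr 1; ring
  rw [hsplit]
  refine mul_le_mul_of_nonneg_right ?_ (Real.rpow_nonneg hx0.le _)
  exact Real.rpow_le_rpow (le_trans zero_le_one hM) hxi (by linarith)

/-- **Large-block transfer** (TYPED; conjecture-grade only in the sense "not yet formalised" — the
printed ingredients are theorems): `LargeBlockAbelianDesigns → HomocyclicSTPPDesigns`, witnesses
even with `ℓ = 1` and `q` prime.  PLAN (= `Theorems/FourierTwoFamiliesModPCyclicReduction.lean`,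
`primeTwoFamilies_of_abelian_aux`, with the SDPP→STPP lift deleted): given `ε`, (1) fix `L` with
`log 3/log L < α₀ε/12`; (2) invoke the hypothesis at `ε' ≤ ε/2` so small that an STPP family beating
`2+ε'` forces the subgroup generated by elements of order `≤ L` to have size `≤ |H|^c`,
`c·log 3/log 2 < α₀ε/12` (BCCGNSU Thm 3.3 + Lemma 3.4 + Thm 4.14 per prime power `q ≤ L`, tree:
`AddSimultaneousTPP.exists_isBorderTricoloredSumFree`, `IsBorderTricoloredSumFree.exists_isTricoloredSumFree_pi`,
`IsTricoloredSumFree.card_le_of_addEquiv`), and, by `BCCGNSU2017_thmB_explicit`, `|H|` as large as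
needed (tensor powers `AddSimultaneousTPP.pi` keep both hypotheses); (3) count cyclic factors:
`k ≤ c·log₂|H| + log|H|/log L`; (4) `exists_prime_isSTPP_of_addEquiv` (§2) costs `2·3^k ≤ 2|H|^(α₀ε/6)`;
(5) `sum_rpow_gain_of_blocks_ge` (§3a) with `M = |H|^α₀` pays for it.  Consequence for the KILL side
(census § Transfer / Recommendations): `NoHomocyclicSTPP → ¬LargeBlockAbelianDesigns` — the route's
negative milestone would exclude large-block designs in EVERY finite abelian group, the case Pratt
2024 Rem. 4.6 leaves open for Thm 4.4. -/
theorem largeBlockTransfer : LargeBlockAbelianDesigns → HomocyclicSTPPDesigns := by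
  sorry

/-! ## §4 One-shape families must be balanced (calibration for § Strengthen / § Negation) -/

/-- **Single-shape packing** (proved, from the tree's `IsSTPP.packing`): if every block of an STPP
family has the same shape `(a,b,c)` with `a,b,c ≥ 1`, then `N·ab`, `N·bc`, `N·ca ≤ |H|`.  Hence
`Σᵢ(abc)^((2+ε)/3) = N(abc)^((2+ε)/3) ≤ |H|·(abc)^((2+ε)/3)/max(ab,bc,ca)`: a one-shape family beats
`2+ε` only if `(abc)^((2+ε)/3) > max(ab,bc,ca)`, i.e. only for `ε > 3·log(max(ab,bc,ca)/(abc)^(2/3))/log(abc)`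
— unbalanced shapes are dead below a shape-constant `ε`, and tight tiny-block designs in `ℤ/p` must be
three simultaneous near-tilings of `ℤ/p` by the difference sets `Aᵢ − Bᵢ`, `Bᵢ − Cᵢ`, `Cᵢ − Aᵢ`. -/
theorem single_shape_packing {H : Type*} [AddCommGroup H] [Fintype H] [DecidableEq H] {N : ℕ}
    {A B C : Fin N → Finset H} (hS : IsSTPP A B C) {a b c : ℕ} (ha : 0 < a) (hb : 0 < b) (hc : 0 < c)
    (hshape : ∀ i, (A i).card = a ∧ (B i).card = b ∧ (C i).card = c) :
    N * (a * b) ≤ Fintype.card H ∧ N * (b * c) ≤ Fintype.card H ∧ N * (c * a) ≤ Fintype.card H := by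
  have hA : ∀ i, (A i).Nonempty := fun i => Finset.card_pos.1 (by rw [(hshape i).1]; exact ha)
  have hB : ∀ i, (B i).Nonempty := fun i => Finset.card_pos.1 (by rw [(hshape i).2.1]; exact hb)
  have hC : ∀ i, (C i).Nonempty := fun i => Finset.card_pos.1 (by rw [(hshape i).2.2]; exact hc)
  obtain ⟨h1, h2, h3⟩ := hS.packing hA hB hC
  have e1 : ∑ i : Fin N, (A i).card * (B i).card = N * (a * b) := by
    rw [Finset.sum_congr rfl fun i _ => by rw [(hshape i).1, (hshape i).2.1], Finset.sum_const,
      Finset.card_univ, Fintype.card_fin, smul_eq_mul]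
  have e2 : ∑ i : Fin N, (B i).card * (C i).card = N * (b * c) := by
    rw [Finset.sum_congr rfl fun i _ => by rw [(hshape i).2.1, (hshape i).2.2], Finset.sum_const,
      Finset.card_univ, Fintype.card_fin, smul_eq_mul]
  have e3 : ∑ i : Fin N, (C i).card * (A i).card = N * (c * a) := by
    rw [Finset.sum_congr rfl fun i _ => by rw [(hshape i).2.2, (hshape i).1], Finset.sum_const,
      Finset.card_univ, Fintype.card_fin, smul_eq_mul]
  exact ⟨e1 ▸ h1, e2 ▸ h2, e3 ▸ h3⟩

/-! ## §5 Quantitative regime: the modulus of a witness at `ε` exceeds `3 ε_B / ε` -/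

/-- **Witness modulus lower bound** (proved): if an STPP family in `(ℤ/q)^ℓ` beats `2+ε`, then
`3·ε_B < ε·q` with `ε_B = bccgnsuEpsilon > 0` the tree's explicit Thm-B constant (exponent `≤ q` ⟹ no
family beats `2 + 3ε_B/q`, `BCCGNSU2017_thmB_explicit`).  So along any X′-witness sequence
`q ≥ 3ε_B/ε → ∞` at a rate at least linear in `1/ε`. -/
theorem witness_modulus_lower_bound {q ℓ N : ℕ} (hq : IsPrimePow q) {ε : ℝ} (hε : 0 < ε)
    (A B C : Fin N → Finset (Fin ℓ → ZMod q)) (hS : IsSTPP A B C)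
    (hlt : (q : ℝ) ^ ℓ < ∑ i, (((A i).card * (B i).card * (C i).card : ℕ) : ℝ) ^ ((2 + ε) / 3)) :
    3 * bccgnsuEpsilon < ε * q := by
  haveI : NeZero q := ⟨hq.ne_zero⟩
  have hqpos : (0 : ℝ) < q := by exact_mod_cast hq.pos
  by_contra hcon
  push Not at hcon
  -- ε ≤ 3 ε_B / q
  have hle : ε ≤ 3 * (bccgnsuEpsilon / q) := by
    rw [mul_div_assoc']
    rw [le_div_iff₀ hqpos]
    linarith
  have hexp : AddMonoid.exponent (Fin ℓ → ZMod q) ≤ q := by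
    refine AddMonoid.exponent_min' q hq.pos ?_
    intro g
    funext i
    simp [nsmul_eq_mul]
  have hB := BCCGNSU2017_thmB_explicit (Fin ℓ → ZMod q) hexp N A B C hS
  have hcard : (Fintype.card (Fin ℓ → ZMod q) : ℝ) = (q : ℝ) ^ ℓ := by
    rw [Fintype.card_fun, ZMod.card, Fintype.card_fin]; push_cast; rfl
  rw [hcard] at hB
  have hmono := sum_rpow_mono (Finset.univ : Finset (Fin N))
    (fun i => (A i).card * (B i).card * (C i).card) hε.le hle
  have := lt_of_lt_of_le hlt (le_trans hmono hB)
  exact lt_irrefl _ this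

end Summit.MatrixMultiplication.MatrixMultiplication.Cruxes.HomocyclicSTPPDesigns.Strategist
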